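import Literature.NumberTheory.LFunctions.GranvilleMollinLinnikBounds
import Literature.NumberTheory.LFunctions.GranvilleMollinLinnikRanges
import Literature.NumberTheory.LFunctions.SiegelExceptionalZeroBound
import HarnessLib

/-!
# Granville–Mollin (3.3) from the explicit formula (3.1) and the zero-sum bound (3.2)

Topic `Literature/NumberTheory/LFunctions`, sub-namespace `SiegelZero`. Everything in this file is
PROVED (theorems only). We carry out Granville–Mollin's deduction (*Rabinowitsch revisited*, Acta
Arith. 96 (2000), §3, p. 146): "Fix `C > 9`. Inserting (3.2) into (3.1) with `T = |d| log³x`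
gives, for `x > |d|^C`, (3.3) `∑_{p ≤ x} (d/p) log p + x^β/β ≪ x/(|d| log x) + x^{1−c/log|d|}/η`
(after some calculations when `x > e^{|d|}`)", i.e. we prove the tree's named fact
`Literature.NumberTheory.LFunctions.SiegelZero.GranvilleMollin2000_eq33`
(`ExceptionalZeroPrimeSums.lean`) from the two named facts

* `Literature.NumberTheory.LFunctions.truncatedExplicitFormula_psiChar` — (3.1) in
  Montgomery–Vaughan's form, Theorem 12.10 (`ExplicitFormulaPsiChar.lean`), and
* `Literature.NumberTheory.LFunctions.GranvilleMollin2000_eq32` — (3.2), Bombieri's log-free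
  density estimate with the Deuring–Heilbronn factor (`LinnikZeroSumBound.lean`),

with everything else proved in the tree: the identification `χ(p) = (p/q)`
(`PrimitiveQuadraticCharacter.lean`), the zeros of `L(s, χ)` (symmetry, simplicity of `β`, the
small zeros: `GranvilleMollinLinnikZeros.lean`; the Jensen count is the tree's
`Literature.NumberTheory.LFunctions.DirichletDisc.exists_sum_zeroOrder_le_of_subset_closedBall`),
the bound for `C(χ)` and
the splitting of the zero sum (`GranvilleMollinLinnikBounds.lean`), Siegel's theorem for the
size of `1 − β` (`Literature.NumberTheory.LFunctions.Siegel.exists_one_sub_realZero_ge`), and the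
"calculations" (`GranvilleMollinLinnikRanges.lean`).

**Proof.** Write `L = log x`, `T = qL³`, `β = 1 − 1/(η log q)`. By (3.1) at `(x, T)`,
`θ(x;χ) + x^β/β = [θ − Re ψ] + Re[ψ − ψ₀] + Re R − x^{1−β}/(1−β) − Re ∑_{ρ ≠ β, 1−β} m(ρ)x^ρ/ρ
 − Re(½log(x−1) + (χ(−1)/2)log(x+1)) + Re C(χ)`, and each piece is `≪ x/(qL)` except the sum
over the zeros, which is `≤ 4∑_{ρ≠β} m(ρ)x^{Re ρ} + O(x^{1/4} log²q)` and by (3.2)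
`≤ 4K(x^{1/2}T³ + (1−β)(log T)x^{1−c/log T})`; the last term is `≤ 8K x^{1−(c/2)/log q}/η` when
`3 log L ≤ log q` (then `log T ≤ 2 log q`) and `≪ x/(qL)` otherwise (then `q < L³` and
`x^{−c/log T} ≤ e^{−cL/(6 log L)}`). The trust base of `GranvilleMollin2000_eq33` after this file
is exactly `{truncatedExplicitFormula_psiChar, GranvilleMollin2000_eq32}`.

## References

* A. Granville, R. A. Mollin, *Rabinowitsch revisited*, Acta Arith. 96 (2000), 139–153, §3
  (3.1)–(3.3), p. 142 (`GranvilleMollin2000`).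
* H. L. Montgomery, R. C. Vaughan, *Multiplicative Number Theory I*, CUP 2007, Theorem 12.10
  (`MontgomeryVaughan2007`); E. Bombieri, *Le grand crible*, Astérisque 18 (1987), §6
  (`Bombieri1987GrandCrible`).
-/

noncomputable section

open Complex Filter Topology Metric Set Finset
open scoped Real

namespace Literature.NumberTheory.LFunctions.SiegelZero

open Literature.NumberTheory.LFunctions.DirichletZFR DirichletCharacter
open Literature.NumberTheory.Sieve (chebyshevPsiChar)

/-- `1/(η log q) < κ/(log q + log 4)` as soon as `η ≥ 3/κ` (`q ≥ 3`). [folklore] -/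
theorem inv_eta_log_lt {η κ : ℝ} {q : ℝ} (hκ : 0 < κ) (hη : 3 / κ ≤ η) (hq : 3 ≤ q) :
    1 / (η * Real.log q) < κ / (Real.log q + Real.log 4) := by
  have hlog3 : 1 < Real.log q := by
    rw [← Real.log_exp 1]
    refine Real.log_lt_log (Real.exp_pos 1) (lt_of_lt_of_le ?_ hq)
    have := Real.exp_one_lt_d9; norm_num at this; linarith
  have hlogq : 0 < Real.log q := by linarith
  have hl4 : Real.log 4 < 2 * Real.log q := by
    have h43 : Real.log 4 < Real.log 9 := Real.log_lt_log (by norm_num) (by norm_num)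
    have h9 : Real.log 9 = 2 * Real.log 3 := by
      rw [show (9 : ℝ) = 3 ^ 2 by norm_num, Real.log_pow]; norm_num
    have h3q : Real.log 3 ≤ Real.log q := Real.log_le_log (by norm_num) hq
    linarith
  have hη0 : 0 < η := lt_of_lt_of_le (by positivity) hη
  have hηκ : 3 ≤ η * κ := by rwa [div_le_iff₀ hκ] at hη
  rw [div_lt_div_iff₀ (by positivity) (by positivity)]
  nlinarith

/-- The terms of (12.6) coming from the trivial zero and the pole at `0`:
`‖½ log(x − 1) + (χ(−1)/2) log(x + 1)‖ ≤ log x + 1/2` for `x ≥ 2`. [folklore] -/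
theorem norm_trivialTerms_le {q : ℕ} (χ : DirichletCharacter ℂ q) {x : ℝ} (hx : 2 ≤ x) :
    ‖1 / 2 * ((Real.log (x - 1) : ℝ) : ℂ) + χ (-1) / 2 * ((Real.log (x + 1) : ℝ) : ℂ)‖ ≤
      Real.log x + 1 / 2 := by
  have hx0 : 0 < x := by linarith
  have hl1 : ‖((Real.log (x - 1) : ℝ) : ℂ)‖ ≤ Real.log x := by
    rw [Complex.norm_real, Real.norm_of_nonneg (Real.log_nonneg (by linarith))]
    exact Real.log_le_log (by linarith) (by linarith)
  have hl2 : ‖((Real.log (x + 1) : ℝ) : ℂ)‖ ≤ Real.log x + 1 := by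
    rw [Complex.norm_real, Real.norm_of_nonneg (Real.log_nonneg (by linarith))]
    have he : x + 1 ≤ x * Real.exp 1 := by
      have := Real.add_one_le_exp (1 : ℝ); nlinarith
    calc Real.log (x + 1) ≤ Real.log (x * Real.exp 1) := Real.log_le_log (by linarith) he
      _ = Real.log x + 1 := by rw [Real.log_mul hx0.ne' (Real.exp_pos 1).ne', Real.log_exp]
  have hχn : ‖χ (-1) / 2‖ ≤ 1 / 2 := by
    rw [norm_div, Complex.norm_two]
    exact div_le_div_of_nonneg_right (χ.norm_le_one _) (by norm_num)
  calc ‖1 / 2 * ((Real.log (x - 1) : ℝ) : ℂ) + χ (-1) / 2 * ((Real.log (x + 1) : ℝ) : ℂ)‖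
      ≤ ‖1 / 2 * ((Real.log (x - 1) : ℝ) : ℂ)‖ + ‖χ (-1) / 2 * ((Real.log (x + 1) : ℝ) : ℂ)‖ :=
        norm_add_le _ _
    _ = 1 / 2 * ‖((Real.log (x - 1) : ℝ) : ℂ)‖ + ‖χ (-1) / 2‖ * ‖((Real.log (x + 1) : ℝ) : ℂ)‖ := by
        rw [norm_mul, norm_mul]; norm_num
    _ ≤ 1 / 2 * Real.log x + 1 / 2 * (Real.log x + 1) := by gcongr
    _ = Real.log x + 1 / 2 := by ring

/-- **The bookkeeping of the final estimate** (pure linear arithmetic): with `X = x/(qL)` and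
`P = x^{1−(c/2)/log q}/η`, the seven pieces of `θ + x^β/β` combine to
`(9K₁ + 8K₂ + 8)(X + P)`. [folklore] -/
theorem final_combination {θ m t₁ n₁ n₂ nE nm nA nC K₁ K₂ L X P : ℝ}
    (htri : |θ + m| ≤ t₁ + n₁ + n₂ + (nE + nm + nA + nC)) (ha : t₁ ≤ X)
    (hb : n₁ + nA + K₁ * L ≤ (K₁ + 10) * L) (hb' : (K₁ + 10) * L ≤ X) (hm : nm ≤ X)
    (hE : nE ≤ X + (8 * K₂ * P + X) + X) (hC : nC ≤ X) (hR : n₂ ≤ K₁ * L + 9 * K₁ * X)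
    (hX : 0 ≤ X) (hP : 0 ≤ P) (hK₁ : 0 ≤ K₁) (hK₂ : 0 ≤ K₂) :
    |θ + m| ≤ (9 * K₁ + 8 * K₂ + 8) * (X / 1 + P) := by
  have h1 : 0 ≤ K₁ * P := mul_nonneg hK₁ hP
  have h2 : 0 ≤ K₂ * X := mul_nonneg hK₂ hX
  have h3 : 0 ≤ K₁ * X := mul_nonneg hK₁ hX
  rw [div_one]
  nlinarith

set_option maxHeartbeats 1600000 in
/-- **Granville–Mollin 2000, (3.3), from (3.1) and (3.2).** The named fact
`Literature.NumberTheory.LFunctions.SiegelZero.GranvilleMollin2000_eq33` follows from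
Montgomery–Vaughan's truncated explicit formula for `ψ(x, χ)`
(`Literature.NumberTheory.LFunctions.truncatedExplicitFormula_psiChar`, the input (3.1)) and
Granville–Mollin's form of Bombieri's zero-sum bound
(`Literature.NumberTheory.LFunctions.GranvilleMollin2000_eq32`, the input (3.2)), "inserting (3.2)
into (3.1) with `T = |d| log³ x`". The proof is one long assembly of the estimates of the companion
files and is elaborated with a raised heartbeat limit. [cite: GranvilleMollin2000, §3 (3.3)] -/
theorem GranvilleMollin2000_eq33_of_explicitFormula_of_eq32
    (h₁ : truncatedExplicitFormula_psiChar) (h₂ : GranvilleMollin2000_eq32) :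
    GranvilleMollin2000_eq33 := by
  classical
  intro C hC
  -- constants from the two named facts
  obtain ⟨K₁, hK₁⟩ := h₁ 2 one_lt_two
  obtain ⟨C', hC'def⟩ : ∃ C' : ℝ, C' = (9 + C) / 2 := ⟨_, rfl⟩
  have hC'9 : 9 < C' := by rw [hC'def]; linarith
  have hC'C : C' < C := by rw [hC'def]; linarith
  have hC0 : 0 < C := by linarith
  obtain ⟨c, hc, c₁, hc₁, K₂, T₀, hF2⟩ := h₂ C' hC'9
  -- constants from the tree
  obtain ⟨c₄, hc₄, hsimple⟩ := exists_deriv_ne_zero_of_realZero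
  obtain ⟨c₀, hc₀, hsmall⟩ := exists_re_ge_of_smallZero
  obtain ⟨KJ, hKJpos, hJensen⟩ :=
    DirichletDisc.exists_sum_zeroOrder_le_of_subset_closedBall (R := 13 / 10) (by norm_num)
      (by norm_num)
  have hKJ : 0 ≤ KJ := hKJpos.le
  obtain ⟨CS, hCS, hSiegel⟩ :=
    Literature.NumberTheory.LFunctions.Siegel.exists_one_sub_realZero_ge (ε := 1) one_pos
  obtain ⟨cE, hcE, C₅, hC₅, hConst⟩ := exists_norm_explicitFormulaConst_le
  obtain ⟨K₁', hK₁'⟩ : ∃ K : ℝ, K = max K₁ 0 := ⟨_, rfl⟩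
  obtain ⟨K₂', hK₂'⟩ : ∃ K : ℝ, K = max K₂ 0 := ⟨_, rfl⟩
  have hK₁'0 : 0 ≤ K₁' := by rw [hK₁']; exact le_max_right _ _
  have hK₂'0 : 0 ≤ K₂' := by rw [hK₂']; exact le_max_right _ _
  have hK₁le : K₁ ≤ K₁' := by rw [hK₁']; exact le_max_left _ _
  have hK₂le : K₂ ≤ K₂' := by rw [hK₂']; exact le_max_left _ _
  obtain ⟨L₀, hL₀, hthr⟩ := exists_linnikRange_threshold C C' K₁' K₂' CS KJ c₀ C₅ c T₀ hC'C hC'9 hc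
  -- the constants of (3.3)
  obtain ⟨η₀, hη₀⟩ : ∃ η₀ : ℝ, η₀ = max (max 9 (3 / c₁)) (max (max (3 / c₄) (3 / c₀)) (3 / cE)) :=
    ⟨_, rfl⟩
  refine ⟨c / 2, half_pos hc, 9 * K₁' + 8 * K₂' + 8, η₀, Real.exp L₀, ?_⟩
  intro q _ hsqf hq4 hqq₀ χ hprim hquad η hη hLβ x hx
  /- ### Step 0: sizes of `q`, `η`, `x`, `L`, `T` -/
  have hq3n : 3 ≤ q := by omega
  have hq3 : (3 : ℝ) ≤ q := by exact_mod_cast hq3n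
  have hq1 : (1 : ℝ) ≤ q := by linarith
  have hq0 : (0 : ℝ) < q := by linarith
  have hqodd : Odd q := Nat.odd_iff.2 (by omega)
  have hχ1 : χ ≠ 1 := by
    intro h
    have : χ.conductor = 1 := by rw [h, conductor_one]
    rw [hprim] at this
    omega
  have hχ2 : χ ^ 2 = 1 := hquad.sq_eq_one
  have hlogq1 : 1 < Real.log q := by
    rw [← Real.log_exp 1]
    refine Real.log_lt_log (Real.exp_pos 1) (lt_of_lt_of_le ?_ hq3)
    have := Real.exp_one_lt_d9; norm_num at this; linarith
  have hlogq0 : 0 < Real.log q := by linarith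
  have hη9 : 9 ≤ η := le_trans (by rw [hη₀]; exact (le_max_left _ _).trans (le_max_left _ _)) hη
  have hη0 : 0 < η := by linarith
  have hηc₁ : 3 / c₁ ≤ η :=
    le_trans (by rw [hη₀]; exact (le_max_right _ _).trans (le_max_left _ _)) hη
  have hηc₄ : 3 / c₄ ≤ η :=
    le_trans (by rw [hη₀]; exact (le_max_left _ _).trans ((le_max_left _ _).trans (le_max_right _ _))) hη
  have hηc₀ : 3 / c₀ ≤ η :=
    le_trans (by rw [hη₀]; exact (le_max_right _ _).trans ((le_max_left _ _).trans (le_max_right _ _))) hη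
  have hηcE : 3 / cE ≤ η :=
    le_trans (by rw [hη₀]; exact (le_max_right _ _).trans (le_max_right _ _)) hη
  -- `β` and `ν = 1 - β`
  obtain ⟨ν, hν⟩ : ∃ ν : ℝ, ν = 1 / (η * Real.log q) := ⟨_, rfl⟩
  obtain ⟨β, hβdef⟩ : ∃ β : ℝ, β = 1 - 1 / (η * Real.log q) := ⟨_, rfl⟩
  rw [← hβdef] at hLβ ⊢
  have hν0 : 0 < ν := by rw [hν]; positivity
  have hν9 : ν ≤ 1 / 9 := by
    rw [hν]
    refine one_div_le_one_div_of_le (by norm_num) ?_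
    calc (9 : ℝ) = 9 * 1 := by norm_num
      _ ≤ η * Real.log q := mul_le_mul hη9 hlogq1.le zero_le_one hη0.le
  have h1β : 1 - β = ν := by rw [hβdef, hν]; ring
  have hβ1 : β < 1 := by linarith
  have hβhalf : 1 / 2 < β := by linarith
  have hβ0 : χ.LFunction β = 0 := hLβ
  have hβκ : ∀ κ : ℝ, 0 < κ → 3 / κ ≤ η → 1 - κ / (Real.log q + Real.log 4) < β := by
    intro κ hκ hηκ
    have := inv_eta_log_lt hκ hηκ hq3
    rw [hβdef]; linarith
  -- `x`, `L`
  have hqC1 : (1 : ℝ) ≤ (q : ℝ) ^ C := Real.one_le_rpow hq1 hC0.le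
  have hx1 : 1 < x := lt_of_le_of_lt hqC1 hx
  have hx0 : 0 < x := by linarith
  obtain ⟨L, hLdef⟩ : ∃ L : ℝ, L = Real.log x := ⟨_, rfl⟩
  have hxL : x = Real.exp L := by rw [hLdef, Real.exp_log hx0]
  have hClogq : C * Real.log q < L := by
    rw [hLdef, ← Real.log_rpow hq0]; exact Real.log_lt_log (by positivity) hx
  have hlogq₀ : L₀ ≤ Real.log q := by
    rw [← Real.log_exp L₀]; exact Real.log_le_log (Real.exp_pos _) hqq₀
  have hLL₀ : L₀ ≤ L := by
    have : Real.log q ≤ C * Real.log q := le_mul_of_one_le_left hlogq0.le (by linarith)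
    linarith
  have hL18 : 18 ≤ L := hL₀.trans hLL₀
  have hL1 : 1 ≤ L := by linarith
  have hlogqC : Real.log q ≤ L / C := by rw [le_div_iff₀ hC0]; linarith
  have hlogq9 : Real.log q ≤ L / 9 := by
    have : L / C ≤ L / 9 := div_le_div_of_nonneg_left (by linarith) (by norm_num) hC.le
    linarith
  have hqL : (q : ℝ) ≤ Real.exp (L / 9) := by
    rw [← Real.exp_log hq0]; exact Real.exp_le_exp.2 hlogq9
  have hx2 : (2 : ℝ) ≤ x := by
    rw [hxL]; have := Real.add_one_le_exp L; linarith
  obtain ⟨hI1, hI2, hI3, hI4, hI5, hI6, hI7, hI8, hI9, hI10⟩ := hthr L hLL₀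
  -- `T`
  obtain ⟨T, hTdef⟩ : ∃ T : ℝ, T = q * L ^ 3 := ⟨_, rfl⟩
  have hT0 : 0 < T := by rw [hTdef]; positivity
  have hqT : (q : ℝ) ≤ T := by
    rw [hTdef]; exact le_mul_of_one_le_right hq0.le (one_le_pow₀ hL1)
  have hT2 : 2 ≤ T := by linarith
  have hTT₀ : T₀ ≤ T := by
    rw [hTdef]; exact hI2.trans (le_mul_of_one_le_left (by positivity) hq1)
  have hlogT : Real.log T = Real.log q + 3 * Real.log L := by
    rw [hTdef, Real.log_mul hq0.ne' (by positivity), Real.log_pow]; push_cast; ring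
  have hxT : T ^ C' ≤ x := rpow_T_le hxL hq1 hL1 (by linarith) hlogqC hTdef hI1
  /- ### Step 1: the explicit formula (3.1) -/
  have hq1n : 1 < q := by omega
  have hEF := hK₁ q hq1n χ hprim x hx2 T hT2
  rw [sub_sub (-charZeroSumTrunc χ x T)] at hEF
  obtain ⟨A, hA⟩ : ∃ A : ℂ, A = 1 / 2 * ((Real.log (x - 1) : ℝ) : ℂ) +
      χ (-1) / 2 * ((Real.log (x + 1) : ℝ) : ℂ) := ⟨_, rfl⟩
  rw [← hA] at hEF
  obtain ⟨ψc, hψc⟩ : ∃ z : ℂ, z = chebyshevPsiChar χ x := ⟨_, rfl⟩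
  obtain ⟨ψ0, hψ0⟩ : ∃ z : ℂ, z = chebyshevPsiChar₀ χ x := ⟨_, rfl⟩
  obtain ⟨Z, hZ⟩ : ∃ z : ℂ, z = charZeroSumTrunc χ x T := ⟨_, rfl⟩
  obtain ⟨Cχ, hCχ⟩ : ∃ z : ℂ, z = explicitFormulaConst χ := ⟨_, rfl⟩
  rw [← hψ0, ← hZ, ← hCχ] at hEF
  have hEF' : ‖ψ0 - (-Z - A + Cχ)‖ ≤ K₁' * (L + 9 * (x / (q * L))) := by
    have hnn : 0 ≤ Real.log x * min 1 (x / (T * primePowDist x)) + x / T * Real.log (q * x * T) ^ 2 := by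
      have : 0 ≤ min 1 (x / (T * primePowDist x)) :=
        le_min zero_le_one (div_nonneg hx0.le (mul_nonneg hT0.le (primePowDist_nonneg x)))
      have : 0 ≤ Real.log x := by rw [← hLdef]; linarith
      positivity
    have h2 : Real.log x * min 1 (x / (T * primePowDist x)) + x / T * Real.log (q * x * T) ^ 2 ≤
        L + 9 * (x / (q * L)) := by
      have hm : Real.log x * min 1 (x / (T * primePowDist x)) ≤ L := by
        rw [← hLdef]
        calc L * min 1 (x / (T * primePowDist x)) ≤ L * 1 :=
              mul_le_mul_of_nonneg_left (min_le_left _ _) (by linarith)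
          _ = L := mul_one L
      have ht := truncation_term_le hxL hq1 hlogq9 hL1 hI3 hTdef
      linarith
    calc ‖ψ0 - (-Z - A + Cχ)‖ ≤ K₁ * _ := hEF
      _ ≤ K₁' * (Real.log x * min 1 (x / (T * primePowDist x)) + x / T * Real.log (q * x * T) ^ 2) :=
          mul_le_mul_of_nonneg_right hK₁le hnn
      _ ≤ K₁' * (L + 9 * (x / (q * L))) := mul_le_mul_of_nonneg_left h2 hK₁'0
  /- ### Step 2: the zero-sum bound (3.2) -/
  have hβc₁ : 1 - c₁ / Real.log (2 * q) < β := by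
    have h := hβκ c₁ hc₁ hηc₁
    have hle : c₁ / (Real.log q + Real.log 4) ≤ c₁ / Real.log (2 * q) := by
      rw [Real.log_mul (by norm_num) hq0.ne']
      refine div_le_div_of_nonneg_left hc₁.le (by positivity) ?_
      have : Real.log 2 ≤ Real.log 4 := Real.log_le_log (by norm_num) (by norm_num)
      linarith
    linarith
  have hPS : charZeroPowerSum χ x T {(β : ℂ)} ≤
      K₂' * (x ^ (1 / 2 : ℝ) * T ^ (3 : ℝ) + (1 - β) * Real.log T * x ^ (1 - c / Real.log T)) := by
    have h := (hF2 q χ hχ1 hprim hquad T hTT₀ hqT x hxT).2 β hβc₁ hβ0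
    have hlogT0 : 0 ≤ Real.log T := Real.log_nonneg (by linarith)
    have hnn : 0 ≤ x ^ (1 / 2 : ℝ) * T ^ (3 : ℝ) + (1 - β) * Real.log T * x ^ (1 - c / Real.log T) := by
      have : 0 ≤ 1 - β := by linarith
      positivity
    exact h.trans (mul_le_mul_of_nonneg_right hK₂le hnn)
  /- ### Step 3: the zeros `β`, `1 - β` and the others -/
  have hmβ : DirichletDisc.zeroOrder χ β = 1 :=
    zeroOrder_eq_one_of_deriv_ne_zero hχ1 hβ0 (hsimple q χ hχ1 β hβ0 (hβκ c₄ hc₄ hηc₄))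
  have hJ' : ∀ S : Finset ℂ,
      (∀ u ∈ S, u ∈ closedBall (2 + ((0 : ℝ) : ℂ) * I) (13 / 10) ∧ χ.LFunction u = 0) →
        (∑ ρ ∈ S, (DirichletDisc.zeroOrder χ ρ : ℝ)) ≤ KJ * (Real.log q + Real.log 4) := by
    intro S hS
    have := hJensen q χ hχ1 0 S hS
    rwa [abs_zero, zero_add] at this
  have hr₀ : 0 < c₀ / (Real.log q + Real.log 5) := by
    have : 0 < Real.log 5 := Real.log_pos (by norm_num)
    positivity
  have hZsum := norm_charZeroSumTrunc_sub_le hχ1 hprim hquad hβ0 hβhalf hβ1 hmβ hr₀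
    (hsmall q χ hχ1 hprim hquad β hβ0 (hβκ c₀ hc₀ hηc₀)) hJ' hx1.le hT0.le
  rw [← hZ] at hZsum
  /- ### Step 4: `θ` versus `ψ`, `ψ₀`, and `C(χ)` -/
  have hθψ := abs_jacobiTheta_sub_re_le hqodd hsqf χ hprim hquad hx1.le
  rw [← hψc, ← hLdef] at hθψ
  have hψ₀ψ := norm_chebyshevPsiChar₀_sub_le χ hx1.le
  rw [← hψc, ← hψ0, ← hLdef] at hψ₀ψ
  have hCχ' := hConst q χ hχ1 hquad β hβ0 (hβκ cE hcE hηcE)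
  rw [← hCχ] at hCχ'
  /- ### Step 5: the identity and the triangle inequality -/
  obtain ⟨mβ, hmβdef⟩ : ∃ m : ℝ, m = x ^ β / β := ⟨_, rfl⟩
  obtain ⟨m₂, hm₂def⟩ : ∃ m : ℝ, m = x ^ (1 - β) / (1 - β) := ⟨_, rfl⟩
  rw [← hmβdef, ← hm₂def] at hZsum
  rw [← hmβdef]
  obtain ⟨E, hEdef⟩ : ∃ E : ℂ, E = Z - (mβ : ℂ) - (m₂ : ℂ) := ⟨_, rfl⟩
  rw [← hEdef] at hZsum
  have hid : jacobiTheta q x + mβ =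
      (jacobiTheta q x - ψc.re) + ((ψc - ψ0) + (ψ0 - (-Z - A + Cχ)) + (-E - (m₂ : ℂ) - A + Cχ)).re := by
    have hcx : (ψc - ψ0) + (ψ0 - (-Z - A + Cχ)) + (-E - (m₂ : ℂ) - A + Cχ) = ψc + (mβ : ℂ) := by
      rw [hEdef]; ring
    rw [hcx, Complex.add_re, Complex.ofReal_re]; ring
  have htri : |jacobiTheta q x + mβ| ≤ |jacobiTheta q x - ψc.re| + ‖ψc - ψ0‖ +
      ‖ψ0 - (-Z - A + Cχ)‖ + (‖E‖ + ‖(m₂ : ℂ)‖ + ‖A‖ + ‖Cχ‖) := by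
    rw [hid]
    refine (abs_add_le _ _).trans ?_
    have hre : |((ψc - ψ0) + (ψ0 - (-Z - A + Cχ)) + (-E - (m₂ : ℂ) - A + Cχ)).re| ≤
        ‖(ψc - ψ0) + (ψ0 - (-Z - A + Cχ)) + (-E - (m₂ : ℂ) - A + Cχ)‖ := Complex.abs_re_le_norm _
    have h3 : ‖(ψc - ψ0) + (ψ0 - (-Z - A + Cχ)) + (-E - (m₂ : ℂ) - A + Cχ)‖ ≤
        ‖ψc - ψ0‖ + ‖ψ0 - (-Z - A + Cχ)‖ + ‖-E - (m₂ : ℂ) - A + Cχ‖ := norm_add₃_le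
    have h4 : ‖-E - (m₂ : ℂ) - A + Cχ‖ ≤ ‖E‖ + ‖(m₂ : ℂ)‖ + ‖A‖ + ‖Cχ‖ := by
      have e1 := norm_add_le (-E - (m₂ : ℂ) - A) Cχ
      have e2 := norm_sub_le (-E - (m₂ : ℂ)) A
      have e3 := norm_sub_le (-E) (m₂ : ℂ)
      rw [norm_neg] at e3
      linarith
    linarith
  /- ### Step 6: the size of each piece -/
  -- (a) prime powers
  have ha : |jacobiTheta q x - ψc.re| ≤ x / (q * L) :=
    hθψ.trans (sqrt_term_le hxL hq1 hqL hL1 hI4)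
  -- (b) `ψ − ψ₀`, the trivial terms `A`, and the `L`-part of `R`
  have hAn : ‖A‖ ≤ L + 1 / 2 := by
    rw [hA, hLdef]; exact norm_trivialTerms_le χ hx2
  have hb : ‖ψc - ψ0‖ + ‖A‖ + K₁' * L ≤ (K₁' + 10) * L := by
    rw [norm_sub_rev] at hψ₀ψ ⊢
    have : ‖ψ0 - ψc‖ = ‖ψc - ψ0‖ := norm_sub_rev _ _
    linarith
  have hb' : (K₁' + 10) * L ≤ x / (q * L) := linear_term_le hxL hq1 hqL hL1 hI5
  -- (c) the zero `1 − β`, through Siegel's bound `1/(1 − β) ≤ q/C_S`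
  have hS : 1 / (1 - β) ≤ q / CS := by
    have h := hSiegel q χ hχ2 hχ1 β hβ0
    rw [Real.rpow_neg hq0.le, Real.rpow_one] at h
    have h1β0 : 0 < 1 - β := by linarith
    rw [div_le_div_iff₀ h1β0 hCS]
    calc 1 * CS = CS * (q : ℝ)⁻¹ * q := by field_simp
      _ ≤ (1 - β) * q := mul_le_mul_of_nonneg_right h hq0.le
      _ = q * (1 - β) := mul_comm _ _
  have hm₂ : ‖(m₂ : ℂ)‖ ≤ x / (q * L) := by
    have hm₂0 : 0 ≤ m₂ := by rw [hm₂def, h1β]; positivity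
    rw [Complex.norm_real, Real.norm_of_nonneg hm₂0, hm₂def, h1β]
    rw [h1β] at hS
    calc x ^ ν / ν = x ^ ν * (1 / ν) := by ring
      _ ≤ x ^ ν * (q / CS) := mul_le_mul_of_nonneg_left hS (Real.rpow_nonneg hx0.le _)
      _ ≤ x / (q * L) := smallPower_term_le hxL hq1 hqL hL1 hν9 hCS hI6
  -- (d) the other zeros
  have hE : ‖E‖ ≤ x / (q * L) + (8 * K₂' * (x ^ (1 - c / 2 / Real.log q) / η) + x / (q * L)) +
      x / (q * L) := by
    have hd1 : 4 * K₂' * (x ^ (1 / 2 : ℝ) * T ^ (3 : ℝ)) ≤ x / (q * L) :=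
      density_term_le hxL hq1 hqL hL1 hTdef hI7
    have hd2 : 4 * K₂' * ((1 - β) * Real.log T * x ^ (1 - c / Real.log T)) ≤
        8 * K₂' * (x ^ (1 - c / 2 / Real.log q) / η) + x / (q * L) := by
      have hnn1 : 0 ≤ 8 * K₂' * (x ^ (1 - c / 2 / Real.log q) / η) := by positivity
      have hnn2 : 0 ≤ x / (q * L) := by positivity
      rcases le_or_gt (3 * Real.log L) (Real.log q) with hcase | hcase
      · have := delta_term_le_of_le hx1.le hK₂'0 hη0 hc hlogq1.le (by rw [h1β, hν]) hlogT
          (Real.log_nonneg hL1) hcase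
        linarith
      · have h1β0 : 0 ≤ 1 - β := by linarith
        have h1β1 : 1 - β ≤ 1 := by linarith
        have := delta_term_le_of_lt hxL hq1 hL18 hK₂'0 hc h1β0 h1β1 hlogT hcase hI8
        linarith
    have hd3 : x ^ (1 / 4 : ℝ) / (c₀ / (Real.log q + Real.log 5)) * (KJ * (Real.log q + Real.log 4)) ≤
        x / (q * L) := smallZeros_term_le hxL hq1 hqL hlogq9 hL18 hKJ hc₀ hI9
    have hsplit : 4 * charZeroPowerSum χ x T {(β : ℂ)} ≤
        4 * K₂' * (x ^ (1 / 2 : ℝ) * T ^ (3 : ℝ)) +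
          4 * K₂' * ((1 - β) * Real.log T * x ^ (1 - c / Real.log T)) := by
      have := mul_le_mul_of_nonneg_left hPS (by norm_num : (0 : ℝ) ≤ 4)
      linarith
    linarith [hZsum]
  -- (e) the constant `C(χ)`
  have hCb : ‖Cχ‖ ≤ x / (q * L) :=
    hCχ'.trans (const_term_le hxL hq1 hqL hlogq9 hL18 hC₅ (by linarith) hS hI10)
  -- (f) the remainder `R`
  have hR : ‖ψ0 - (-Z - A + Cχ)‖ ≤ K₁' * L + 9 * K₁' * (x / (q * L)) := by linarith [hEF']
  /- ### Step 7: conclusion -/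
  have hxqL : 0 ≤ x / (q * L) := by positivity
  have hpow : 0 ≤ x ^ (1 - c / 2 / Real.log q) / η := by positivity
  have hfin := final_combination htri ha hb hb' hm₂ hE hCb hR hxqL hpow hK₁'0 hK₂'0
  rw [div_one] at hfin
  rw [← hLdef]
  exact hfin

/-- **The trust base of Granville–Mollin's (3.3) made explicit**: the named fact
`GranvilleMollin2000_eq33` holds as soon as the two classical inputs (3.1) (Montgomery–Vaughan
Theorem 12.10) and (3.2) (Bombieri's log-free density estimate with the Deuring–Heilbronn
factor, in Granville–Mollin's form) are supplied. [cite: GranvilleMollin2000, §3 (3.1)–(3.3)] -/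
theorem GranvilleMollin2000_eq33_of_inputs
    (h : truncatedExplicitFormula_psiChar ∧ GranvilleMollin2000_eq32) :
    GranvilleMollin2000_eq33 :=
  GranvilleMollin2000_eq33_of_explicitFormula_of_eq32 h.1 h.2

end Literature.NumberTheory.LFunctions.SiegelZero

end
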